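import Mathlib
import Summits.MatrixMultiplication.MatrixMultiplication.Theorems.FidelityWitnessesRankTwoAdditivityNorms

/-!
# `FidelityWitnesses.RankTwoAdditivity` (stmt-MatrixMultiplication-4964) — explicit frames for the transport

The Gram–Schmidt frame on the `Y`-side (`frameQ`), the projector frame on `ℂ² ⊗ ℂ²` (`frameW`), the
sum-of-squares form of `H` (`H_sos`), and `norm_sq_scaled_diff` — the ingredients for transporting Theorem A to
the 2×2 certificate of the core inequality.
Supports item `stmt-MatrixMultiplication-4964`; no definitions are introduced.
-/

namespace Summit.MatrixMultiplication.MatrixMultiplication.Theorems.RankTwoAdditivity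

open scoped BigOperators ComplexConjugate

/-- Gram–Schmidt frame on the `Y`-side: for unit `v₁, v₂` with `y = ⟨v₁,v₂⟩`, `|y| < 1`, the pair
`Q 0 = v₁`, `Q 1 = τ⁻¹ (v₂ − y v₁)` (`τ = √(1−|y|²)`) is HS-orthonormal and `v₂ = y Q 0 + τ Q 1`. -/
theorem frameQ {ν : Type*} [Fintype ν] (v₁ v₂ : ν → ℂ)
    (h₁ : (∑ c, ‖v₁ c‖ ^ 2) = 1) (h₂ : (∑ c, ‖v₂ c‖ ^ 2) = 1)
    (hy : ‖∑ c, conj (v₁ c) * v₂ c‖ < 1) :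
    let y : ℂ := ∑ c, conj (v₁ c) * v₂ c
    let τ : ℝ := Real.sqrt (1 - ‖y‖ ^ 2)
    let Q : Fin 2 → ν → ℂ := fun k c => if k = 0 then v₁ c else (τ : ℂ)⁻¹ * (v₂ c - y * v₁ c)
    (∀ k l, (∑ c, conj (Q k c) * Q l c) = if k = l then 1 else 0) ∧ 0 < τ ∧ τ ^ 2 = 1 - ‖y‖ ^ 2
      ∧ (∀ c, v₂ c = y * Q 0 c + (τ : ℂ) * Q 1 c) := by
  intro y τ Q
  have hτ2 : τ ^ 2 = 1 - ‖y‖ ^ 2 := Real.sq_sqrt (by nlinarith [norm_nonneg y])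
  have hτpos : 0 < τ := Real.sqrt_pos.2 (by nlinarith [norm_nonneg y])
  have hτne : (τ : ℂ) ≠ 0 := by exact_mod_cast hτpos.ne'
  have hQ0 : ∀ c, Q 0 c = v₁ c := fun c => by simp [Q]
  have hQ1 : ∀ c, Q 1 c = (τ : ℂ)⁻¹ * (v₂ c - y * v₁ c) := fun c => by simp [Q]
  -- basic inner products
  have ip11 : (∑ c, conj (v₁ c) * v₁ c) = 1 := by
    have : (∑ c, conj (v₁ c) * v₁ c) = ((∑ c, ‖v₁ c‖ ^ 2 : ℝ) : ℂ) := by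
      push_cast; exact Finset.sum_congr rfl fun c _ => by rw [Complex.conj_mul']
    rw [this, h₁]; simp
  have ip22 : (∑ c, conj (v₂ c) * v₂ c) = 1 := by
    have : (∑ c, conj (v₂ c) * v₂ c) = ((∑ c, ‖v₂ c‖ ^ 2 : ℝ) : ℂ) := by
      push_cast; exact Finset.sum_congr rfl fun c _ => by rw [Complex.conj_mul']
    rw [this, h₂]; simp
  have ip21 : (∑ c, conj (v₂ c) * v₁ c) = conj y := by
    rw [map_sum]; exact Finset.sum_congr rfl fun c _ => by rw [map_mul, Complex.conj_conj, mul_comm]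
  have hyy : y * conj y = ((‖y‖ ^ 2 : ℝ) : ℂ) := by rw [Complex.mul_conj', Complex.ofReal_pow]
  -- the Gram–Schmidt vector r = v₂ − y v₁
  have ipr1 : (∑ c, conj (v₂ c - y * v₁ c) * v₁ c) = 0 := by
    simp only [map_sub, map_mul, sub_mul, Finset.sum_sub_distrib, mul_assoc, ← Finset.mul_sum, ip21, ip11]
    ring
  have ip1r : (∑ c, conj (v₁ c) * (v₂ c - y * v₁ c)) = 0 := by
    simp only [mul_sub, Finset.sum_sub_distrib, ← Finset.mul_sum, mul_left_comm _ y, ip11]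
    change y - y * 1 = 0; ring
  have iprr : (∑ c, conj (v₂ c - y * v₁ c) * (v₂ c - y * v₁ c)) = ((τ ^ 2 : ℝ) : ℂ) := by
    rw [hτ2]; push_cast
    have : ∀ c, conj (v₂ c - y * v₁ c) * (v₂ c - y * v₁ c)
        = conj (v₂ c) * v₂ c - y * (conj (v₂ c) * v₁ c) - conj y * (conj (v₁ c) * v₂ c)
          + y * conj y * (conj (v₁ c) * v₁ c) := by
      intro c; simp only [map_sub, map_mul]; ring
    simp only [this, Finset.sum_add_distrib, Finset.sum_sub_distrib, ← Finset.mul_sum, ip22, ip21, ip11]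
    rw [← Complex.mul_conj' y]; ring
  have c00 : (∑ c, conj (Q 0 c) * Q 0 c) = 1 := by simp only [hQ0]; exact ip11
  have c01 : (∑ c, conj (Q 0 c) * Q 1 c) = 0 := by
    simp only [hQ0, hQ1]
    rw [show (∑ c, conj (v₁ c) * ((τ : ℂ)⁻¹ * (v₂ c - y * v₁ c)))
      = (τ : ℂ)⁻¹ * ∑ c, conj (v₁ c) * (v₂ c - y * v₁ c) by
        rw [Finset.mul_sum]; exact Finset.sum_congr rfl fun c _ => by ring, ip1r, mul_zero]
  have c10 : (∑ c, conj (Q 1 c) * Q 0 c) = 0 := by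
    simp only [hQ0, hQ1]
    rw [show (∑ c, conj ((τ : ℂ)⁻¹ * (v₂ c - y * v₁ c)) * v₁ c)
      = (τ : ℂ)⁻¹ * ∑ c, conj (v₂ c - y * v₁ c) * v₁ c by
        rw [Finset.mul_sum]; exact Finset.sum_congr rfl fun c _ => by
          rw [map_mul, map_inv₀, Complex.conj_ofReal]; ring, ipr1, mul_zero]
  have c11 : (∑ c, conj (Q 1 c) * Q 1 c) = 1 := by
    simp only [hQ1]
    rw [show (∑ c, conj ((τ : ℂ)⁻¹ * (v₂ c - y * v₁ c)) * ((τ : ℂ)⁻¹ * (v₂ c - y * v₁ c)))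
      = (τ : ℂ)⁻¹ * (τ : ℂ)⁻¹ * ∑ c, conj (v₂ c - y * v₁ c) * (v₂ c - y * v₁ c) by
        rw [Finset.mul_sum]; exact Finset.sum_congr rfl fun c _ => by
          rw [map_mul, map_inv₀, Complex.conj_ofReal]; ring, iprr]
    push_cast
    field_simp
  refine ⟨?_, hτpos, hτ2, ?_⟩
  · intro k l
    match k, l with
    | 0, 0 => simpa using c00
    | 0, 1 => simpa using c01
    | 1, 0 => simpa using c10
    | 1, 1 => simpa using c11
  · intro c
    rw [hQ0, hQ1, ← mul_assoc, mul_inv_cancel₀ hτne, one_mul]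
    ring

/-- The projector frame on `ℂ² ⊗ ℂ²`: `T₁ = e₀ ⊗ e₀`, `T₂ = η ⊗ ξ` with `η = (y, τ)`, `ξ = (x, σ)` unit,
`w 0 = T₁`, `w 1 = ρ⁻¹ (T₂ − (yx) T₁)`, `ρ = √(1 − |yx|²)`: an orthonormal pair. -/
theorem frameW (y x : ℂ) (τ σ : ℝ) (hτ : τ ^ 2 = 1 - ‖y‖ ^ 2) (hσ : σ ^ 2 = 1 - ‖x‖ ^ 2)
    (hp : ‖y * x‖ < 1) :
    let ρ : ℝ := Real.sqrt (1 - ‖y * x‖ ^ 2)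
    let T₂ : Fin 2 × Fin 2 → ℂ := fun a => (if a.1 = 0 then y else (τ : ℂ)) * (if a.2 = 0 then x else (σ : ℂ))
    let w : Fin 2 → Fin 2 × Fin 2 → ℂ := fun r a =>
      if r = 0 then (if a = (0, 0) then 1 else 0)
      else (ρ : ℂ)⁻¹ * (T₂ a - (y * x) * (if a = (0, 0) then 1 else 0))
    (∀ r s, (∑ a, conj (w r a) * w s a) = if r = s then 1 else 0) ∧ 0 < ρ ∧ ρ ^ 2 = 1 - ‖y * x‖ ^ 2 := by
  intro ρ T₂ w
  have hρ2 : ρ ^ 2 = 1 - ‖y * x‖ ^ 2 := Real.sq_sqrt (by nlinarith [norm_nonneg (y * x)])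
  have hρpos : 0 < ρ := Real.sqrt_pos.2 (by nlinarith [norm_nonneg (y * x)])
  have hρne : (ρ : ℂ) ≠ 0 := by exact_mod_cast hρpos.ne'
  -- expand the four sums over Fin 2 × Fin 2
  have key : ∀ r s, (∑ a, conj (w r a) * w s a)
      = conj (w r (0, 0)) * w s (0, 0) + conj (w r (0, 1)) * w s (0, 1)
        + (conj (w r (1, 0)) * w s (1, 0) + conj (w r (1, 1)) * w s (1, 1)) := by
    intro r s
    rw [Fintype.sum_prod_type]
    simp only [Fin.sum_univ_two]
  have w00 : w 0 (0, 0) = 1 := by simp [w]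
  have w01 : w 0 (0, 1) = 0 := by simp [w]
  have w10 : w 0 (1, 0) = 0 := by simp [w]
  have w11 : w 0 (1, 1) = 0 := by simp [w]
  have u00 : w 1 (0, 0) = 0 := by simp [w, T₂]
  have u01 : w 1 (0, 1) = (ρ : ℂ)⁻¹ * (y * (σ : ℂ)) := by simp [w, T₂]
  have u10 : w 1 (1, 0) = (ρ : ℂ)⁻¹ * ((τ : ℂ) * x) := by simp [w, T₂]
  have u11 : w 1 (1, 1) = (ρ : ℂ)⁻¹ * ((τ : ℂ) * (σ : ℂ)) := by simp [w, T₂]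
  have hτC : ((τ : ℂ)) ^ 2 = 1 - y * conj y := by
    rw [Complex.mul_conj', ← Complex.ofReal_pow, ← Complex.ofReal_pow, hτ]; push_cast; ring
  have hσC : ((σ : ℂ)) ^ 2 = 1 - x * conj x := by
    rw [Complex.mul_conj', ← Complex.ofReal_pow, ← Complex.ofReal_pow, hσ]; push_cast; ring
  have hρC : ((ρ : ℂ)) ^ 2 = 1 - (y * conj y) * (x * conj x) := by
    rw [← Complex.ofReal_pow, hρ2, norm_mul, mul_pow]; push_cast
    rw [← Complex.mul_conj', ← Complex.mul_conj']
  refine ⟨?_, hρpos, hρ2⟩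
  intro r s
  rw [key]
  match r, s with
  | 0, 0 => simp [w00, w01, w10, w11]
  | 0, 1 => simp [w00, w01, w10, w11, u00, u01, u10, u11]
  | 1, 0 => simp [w00, w01, w10, w11, u00, u01, u10, u11]
  | 1, 1 =>
      simp only [u00, u01, u10, u11, map_zero, zero_mul, zero_add, map_mul, map_inv₀, Complex.conj_ofReal,
        if_true]
      have hb : (y * conj y) * (σ : ℂ) ^ 2 + (τ : ℂ) ^ 2 * (x * conj x) + (τ : ℂ) ^ 2 * (σ : ℂ) ^ 2 = (ρ : ℂ) ^ 2 := by
        linear_combination (1 + ((τ : ℂ) ^ 2 - (1 - y * conj y))) * hσC + hτC - hρC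
      have hi : (ρ : ℂ)⁻¹ * (ρ : ℂ)⁻¹ * (ρ : ℂ) ^ 2 = 1 := by field_simp
      linear_combination ((ρ : ℂ)⁻¹ * (ρ : ℂ)⁻¹) * hb + hi

/-- The `H`-form as a sum of squares: `Re ∑_{ij} π_ij ⟨φ_i, φ_j⟩ = ∑_r ∑_k ∑_m |∑_j conj(w r (k,j)) φ j m|²`
for `π_ij = ∑_r ∑_k w r (k,i) conj(w r (k,j))`. -/
theorem H_sos {κ : Type*} [Fintype κ] (w : Fin 2 → Fin 2 × Fin 2 → ℂ) (φ : Fin 2 → κ → ℂ) :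
    (∑ i, ∑ j, (∑ r, ∑ k, w r (k, i) * conj (w r (k, j))) * ∑ m, conj (φ i m) * φ j m).re
      = ∑ r, ∑ k, ∑ m, ‖∑ j, conj (w r (k, j)) * φ j m‖ ^ 2 := by
  have hC : (((∑ r, ∑ k, ∑ m, ‖∑ j, conj (w r (k, j)) * φ j m‖ ^ 2 : ℝ)) : ℂ)
      = ∑ i, ∑ j, (∑ r, ∑ k, w r (k, i) * conj (w r (k, j))) * ∑ m, conj (φ i m) * φ j m := by
    push_cast
    -- RHS → ∑ r ∑ k ∑ m ∑ i ∑ j w conj w conj φ φ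
    have R : (∑ i, ∑ j, (∑ r, ∑ k, w r (k, i) * conj (w r (k, j))) * ∑ m, conj (φ i m) * φ j m)
        = ∑ i, ∑ j, ∑ r, ∑ k, ∑ m, w r (k, i) * conj (w r (k, j)) * (conj (φ i m) * φ j m) := by
      refine Finset.sum_congr rfl fun i _ => Finset.sum_congr rfl fun j _ => ?_
      rw [Finset.sum_mul]
      refine Finset.sum_congr rfl fun r _ => ?_
      rw [Finset.sum_mul]
      refine Finset.sum_congr rfl fun k _ => ?_
      rw [Finset.mul_sum]
    have L : ∀ r k m, ((‖∑ j, conj (w r (k, j)) * φ j m‖ : ℂ)) ^ 2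
        = ∑ i, ∑ j, w r (k, i) * conj (w r (k, j)) * (conj (φ i m) * φ j m) := by
      intro r k m
      rw [← Complex.conj_mul', map_sum, Finset.sum_mul]
      refine Finset.sum_congr rfl fun i _ => ?_
      rw [Finset.mul_sum]
      refine Finset.sum_congr rfl fun j _ => ?_
      rw [map_mul, Complex.conj_conj]; ring
    rw [R]
    simp only [L]
    -- reorder: ∑ r ∑ k ∑ m ∑ i ∑ j  =  ∑ i ∑ j ∑ r ∑ k ∑ m
    set T : Fin 2 → Fin 2 → Fin 2 → Fin 2 → κ → ℂ :=
      fun i j r k m => w r (k, i) * conj (w r (k, j)) * (conj (φ i m) * φ j m) with hT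
    change (∑ r, ∑ k, ∑ m, ∑ i, ∑ j, T i j r k m) = ∑ i, ∑ j, ∑ r, ∑ k, ∑ m, T i j r k m
    have e1 : (∑ i, ∑ j, ∑ r, ∑ k, ∑ m, T i j r k m) = ∑ r, ∑ i, ∑ j, ∑ k, ∑ m, T i j r k m := by
      rw [Finset.sum_congr rfl fun i _ => (Finset.sum_comm : (∑ j, ∑ r, ∑ k, ∑ m, T i j r k m) = _),
        Finset.sum_comm]
    have e2 : ∀ r, (∑ i, ∑ j, ∑ k, ∑ m, T i j r k m) = ∑ k, ∑ m, ∑ i, ∑ j, T i j r k m := by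
      intro r
      have a1 : ∀ i, (∑ j, ∑ k, ∑ m, T i j r k m) = ∑ k, ∑ m, ∑ j, T i j r k m := by
        intro i; rw [Finset.sum_comm]; exact Finset.sum_congr rfl fun k _ => Finset.sum_comm
      rw [Finset.sum_congr rfl fun i _ => a1 i, Finset.sum_comm]
      exact Finset.sum_congr rfl fun k _ => Finset.sum_comm
    rw [e1]
    exact (Finset.sum_congr rfl fun r _ => e2 r).symm
  have := congrArg Complex.re hC
  rw [Complex.ofReal_re] at this
  exact this.symm


/-- `∑ ‖α (a − β b)‖² = |α|² (‖a‖² + |β|² ‖b‖² − 2 Re(β ⟨a, b⟩))`. -/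
theorem norm_sq_scaled_diff {ι : Type*} [Fintype ι] (α β : ℂ) (a b : ι → ℂ) :
    (∑ i, ‖α * (a i - β * b i)‖ ^ 2)
      = ‖α‖ ^ 2 * ((∑ i, ‖a i‖ ^ 2) + ‖β‖ ^ 2 * (∑ i, ‖b i‖ ^ 2) - 2 * (β * ∑ i, conj (a i) * b i).re) := by
  have h := norm_sq_add_sum a (fun i => -(β * b i))
  have e0 : ∀ i, ‖α * (a i - β * b i)‖ ^ 2 = ‖α‖ ^ 2 * ‖a i + -(β * b i)‖ ^ 2 := by
    intro i; rw [norm_mul, mul_pow, sub_eq_add_neg]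
  simp only [e0, ← Finset.mul_sum]
  rw [h]
  have e1 : (∑ i, ‖-(β * b i)‖ ^ 2) = ‖β‖ ^ 2 * ∑ i, ‖b i‖ ^ 2 := by
    rw [Finset.mul_sum]; exact Finset.sum_congr rfl fun i _ => by rw [norm_neg, norm_mul, mul_pow]
  have e2 : (∑ i, conj (a i) * -(β * b i)) = -(β * ∑ i, conj (a i) * b i) := by
    rw [Finset.mul_sum, ← Finset.sum_neg_distrib]; exact Finset.sum_congr rfl fun i _ => by ring
  rw [e1, e2, Complex.neg_re]; ring

end Summit.MatrixMultiplication.MatrixMultiplication.Theorems.RankTwoAdditivity
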